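import Summits.CriticalPhenomena.PercolationContinuityZ3.Theorems.PercNearOneGluingNoHeavyLowerTailAntitheticEarTools
import Summits.CriticalPhenomena.PercolationContinuityZ3.Theorems.PercNearOneGluingNoHeavyLowerTailAntitheticBoxShield
import HarnessLib

/-!
# `NoHeavyLowerTail` (stmt-CriticalPhenomena-4575) — antithetic cluster pairs: INDEX-DESCRIBED BOXES on a cycle with an ear
# (kit for THEOREM Θ², HOME/MEMO-gen63.md §3; prim-hp-2 gen 63)

Support file (`--supports stmt-CriticalPhenomena-4575`, hull-port prover `prim-hp-2`, gen 63).  No definitions, no named facts, no sorries;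
standard axioms.  Setting of …AntitheticEarTools (`E = Cyc.edgeSet n v ∪ Cyc.edgeSet ℓ u`, no ear pair is a cycle pair).  A box of the
cycle + ear scheme is DESCRIBED by index data: `rd, bl : ℕ → Prop` (cycle indices fixed red / fixed blue, disjoint) and `er : Prop` (the ear
fixed red, else free); `Fix`, `N` are any sets with the corresponding memberships (`hFix`, `hN`).  This file turns the set-level hypotheses
of `Antithetic.Box.boxes_sum_nonneg` / `Antithetic.Box.dom_of_shielded` into index statements:
* `Cyc.dbox_matches_iff`, `Cyc.dbox_flip` — membership in the box / being opposite off `Fix`, index form;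
* `Cyc.dbox_core_mem_v/u`, `Cyc.dbox_notG_*` — the red core and the "shielding graph" of `Box.dom_of_shielded`, index form;
* `Cyc.dbox_dom` — RED DOMINATION of a described box from an index-level shielding condition: for every fixed-blue cycle pair `k` and
  each of its two orientations `(y, z)`, either `z` lies in the red core or `y` is cut off from `s` in the shielding graph of `z`.
[cite: VandenbergHaggstromKahn2005, §1 p. 3 (open cluster `C_s`)]
-/

noncomputable section

namespace Summit.CriticalPhenomena.PercolationContinuityZ3.Theorems

open Literature.Probability.Percolation
open scoped Classical

namespace Antithetic

namespace Cyc

variable {V : Type*} {n : ℕ} {v : ℕ → V} (hn : 3 ≤ n) (hinj : ∀ i j, i < n → j < n → v i = v j → i = j) (hper : v n = v 0)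
  {ℓ : ℕ} {u : ℕ → V} (hRC : ∀ m, m < ℓ → ∀ i, i < n → edge u m ≠ edge v i)
  (rd bl : ℕ → Prop) (er : Prop) (Fix N : Set (Sym2 V))
  (hFix : ∀ e, e ∈ Fix ↔ (∃ i, i < n ∧ (rd i ∨ bl i) ∧ e = edge v i) ∨ (er ∧ ∃ m, m < ℓ ∧ e = edge u m))
  (hN : ∀ e, e ∈ N ↔ (∃ i, i < n ∧ rd i ∧ e = edge v i) ∨ (er ∧ ∃ m, m < ℓ ∧ e = edge u m))
include hn hinj hper hRC hFix in
/-- A cycle pair is fixed iff its index is red or blue. [this work] -/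
theorem dbox_mem_Fix_v {i : ℕ} (hi : i < n) : edge v i ∈ Fix ↔ rd i ∨ bl i := by
  rw [hFix]
  constructor
  · rintro (⟨i', hi', h, he⟩ | ⟨-, m, hm, he⟩)
    · rwa [edge_inj hn hinj hper hi hi' he]
    · exact absurd he.symm (hRC m hm i hi)
  · exact fun h => Or.inl ⟨i, hi, h, rfl⟩

include hn hinj hper hRC hN in
/-- A cycle pair is in the red pattern iff its index is red. [this work] -/
theorem dbox_mem_N_v {i : ℕ} (hi : i < n) : edge v i ∈ N ↔ rd i := by
  rw [hN]
  constructor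
  · rintro (⟨i', hi', h, he⟩ | ⟨-, m, hm, he⟩)
    · rwa [edge_inj hn hinj hper hi hi' he]
    · exact absurd he.symm (hRC m hm i hi)
  · exact fun h => Or.inl ⟨i, hi, h, rfl⟩

include hRC hFix in
/-- An ear pair is fixed iff the ear is fixed (red). [this work] -/
theorem dbox_mem_Fix_u {m : ℕ} (hm : m < ℓ) : edge u m ∈ Fix ↔ er := by
  rw [hFix]
  constructor
  · rintro (⟨i', hi', -, he⟩ | ⟨h, -⟩)
    · exact absurd he (hRC m hm i' hi')
    · exact h
  · exact fun h => Or.inr ⟨h, m, hm, rfl⟩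

include hRC hN in
/-- An ear pair is in the red pattern iff the ear is fixed (red). [this work] -/
theorem dbox_mem_N_u {m : ℕ} (hm : m < ℓ) : edge u m ∈ N ↔ er := by
  rw [hN]
  constructor
  · rintro (⟨i', hi', -, he⟩ | ⟨h, -⟩)
    · exact absurd he (hRC m hm i' hi')
    · exact h
  · exact fun h => Or.inr ⟨h, m, hm, rfl⟩

include hFix hN in
/-- `N ⊆ Fix ⊆ E` for a described box. [this work] -/
theorem dbox_sub : N ⊆ Fix ∧ Fix ⊆ edgeSet n v ∪ edgeSet ℓ u := by
  constructor
  · intro e he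
    rw [hN] at he; rw [hFix]
    rcases he with ⟨i, hi, h, he⟩ | ⟨h, m, hm, he⟩
    · exact Or.inl ⟨i, hi, Or.inl h, he⟩
    · exact Or.inr ⟨h, m, hm, he⟩
  · intro e he
    rw [hFix] at he
    rcases he with ⟨i, hi, -, he⟩ | ⟨-, m, hm, he⟩
    · exact Or.inl ⟨i, hi, he⟩
    · exact Or.inr ⟨m, hm, he⟩

include hn hinj hper hRC hFix hN in
/-- **Membership in a described box, index form.** [this work] -/
theorem dbox_matches_iff (hdisj : ∀ i, i < n → ¬ (rd i ∧ bl i)) (T : Set (Sym2 V)) :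
    (∀ e ∈ Fix, (e ∈ T ↔ e ∈ N)) ↔
      ((∀ i, i < n → rd i → edge v i ∈ T) ∧ (∀ i, i < n → bl i → edge v i ∉ T) ∧ (er → ∀ m, m < ℓ → edge u m ∈ T)) := by
  constructor
  · intro h
    refine ⟨fun i hi hr => ?_, fun i hi hb hT => ?_, fun he m hm => ?_⟩
    · exact (h _ ((dbox_mem_Fix_v hn hinj hper hRC rd bl er Fix hFix hi).2 (Or.inl hr))).2
        ((dbox_mem_N_v hn hinj hper hRC rd er N hN hi).2 hr)
    · exact hdisj i hi ⟨(dbox_mem_N_v hn hinj hper hRC rd er N hN hi).1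
        ((h _ ((dbox_mem_Fix_v hn hinj hper hRC rd bl er Fix hFix hi).2 (Or.inr hb))).1 hT), hb⟩
    · exact (h _ ((dbox_mem_Fix_u hRC rd bl er Fix hFix hm).2 he)).2 ((dbox_mem_N_u hRC rd er N hN hm).2 he)
  · rintro ⟨hr, hb, he⟩ e heF
    rw [hFix] at heF
    rcases heF with ⟨i, hi, hrb, rfl⟩ | ⟨her, m, hm, rfl⟩
    · rw [dbox_mem_N_v hn hinj hper hRC rd er N hN hi]
      rcases hrb with h | h
      · exact ⟨fun _ => h, fun _ => hr i hi h⟩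
      · exact ⟨fun hT => absurd hT (hb i hi h), fun h' => absurd ⟨h', h⟩ (hdisj i hi)⟩
    · rw [dbox_mem_N_u hRC rd er N hN hm]
      exact ⟨fun _ => her, fun _ => he her m hm⟩

include hn hinj hper hRC hFix in
/-- **Opposite off the box, index form.** [this work] -/
theorem dbox_flip {T T' : Set (Sym2 V)} (hflip : ∀ e ∉ Fix, (e ∈ T' ↔ e ∉ T)) :
    (∀ i, i < n → ¬ rd i → ¬ bl i → (edge v i ∈ T' ↔ edge v i ∉ T)) ∧
      (¬ er → ∀ m, m < ℓ → (edge u m ∈ T' ↔ edge u m ∉ T)) := by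
  constructor
  · intro i hi hr hb
    exact hflip _ fun h => ((dbox_mem_Fix_v hn hinj hper hRC rd bl er Fix hFix hi).1 h).elim hr hb
  · intro he m hm
    exact hflip _ fun h => he ((dbox_mem_Fix_u hRC rd bl er Fix hFix hm).1 h)

include hFix hN in
/-- A fixed-red cycle pair belongs to the red core graph `N ∩ Fix ∩ E`. [this work] -/
theorem dbox_core_mem_v {i : ℕ} (hi : i < n) (hr : rd i) : edge v i ∈ N ∩ Fix ∩ (edgeSet n v ∪ edgeSet ℓ u) := by
  have hNm : edge v i ∈ N := (hN _).2 (Or.inl ⟨i, hi, hr, rfl⟩)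
  have hsub := dbox_sub rd bl er Fix N hFix hN
  exact ⟨⟨hNm, hsub.1 hNm⟩, hsub.2 (hsub.1 hNm)⟩

include hFix hN in
/-- A pair of a fixed-red ear belongs to the red core graph. [this work] -/
theorem dbox_core_mem_u (he : er) {m : ℕ} (hm : m < ℓ) : edge u m ∈ N ∩ Fix ∩ (edgeSet n v ∪ edgeSet ℓ u) := by
  have hNm : edge u m ∈ N := (hN _).2 (Or.inr ⟨he, m, hm, rfl⟩)
  have hsub := dbox_sub rd bl er Fix N hFix hN
  exact ⟨⟨hNm, hsub.1 hNm⟩, hsub.2 (hsub.1 hNm)⟩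

include hFix hN in
/-- A fixed-red cycle pair is not in the shielding graph. [this work] -/
theorem dbox_notG_red (z : V) {i : ℕ} (hi : i < n) (hr : rd i) :
    edge v i ∉ {e | e ∈ edgeSet n v ∪ edgeSet ℓ u ∧ ¬ (e ∈ Fix ∧ e ∈ N) ∧
      ∀ w ∈ e, w ∉ openCluster (N ∩ Fix ∩ (edgeSet n v ∪ edgeSet ℓ u)) z} := by
  intro h
  have hc := dbox_core_mem_v rd bl er Fix N hFix hN hi hr
  exact h.2.1 ⟨hc.1.2, hc.1.1⟩

include hFix hN in
/-- A pair of a fixed-red ear is not in the shielding graph. [this work] -/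
theorem dbox_notG_ear (z : V) (he : er) {m : ℕ} (hm : m < ℓ) :
    edge u m ∉ {e | e ∈ edgeSet n v ∪ edgeSet ℓ u ∧ ¬ (e ∈ Fix ∧ e ∈ N) ∧
      ∀ w ∈ e, w ∉ openCluster (N ∩ Fix ∩ (edgeSet n v ∪ edgeSet ℓ u)) z} := by
  intro h
  have hc := dbox_core_mem_u rd bl er Fix N hFix hN he hm
  exact h.2.1 ⟨hc.1.2, hc.1.1⟩

omit hFix hN in
/-- A pair containing `z` is not in the shielding graph of `z`. [this work] -/
theorem dbox_notG_touch (z : V) {a b : V} (hz : z = a ∨ z = b) :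
    s(a, b) ∉ {e | e ∈ edgeSet n v ∪ edgeSet ℓ u ∧ ¬ (e ∈ Fix ∧ e ∈ N) ∧
      ∀ w ∈ e, w ∉ openCluster (N ∩ Fix ∩ (edgeSet n v ∪ edgeSet ℓ u)) z} := by
  intro h
  rcases hz with rfl | rfl
  · exact h.2.2 z (Sym2.mem_mk_left _ _) (mem_openCluster_self _ _)
  · exact h.2.2 z (Sym2.mem_mk_right _ _) (mem_openCluster_self _ _)

include hn hinj hper hRC hFix hN in
/-- **Red domination of a described box from index-level shielding.**  Suppose that for every fixed-blue index `k < n` and each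
orientation `(y, z) ∈ {(v k, v (k+1)), (v (k+1), v k)}` of the pair, either `z` lies in the red core `openCluster (N ∩ Fix ∩ E) s` or `y`
is not in the cluster of `s` in the shielding graph of `z`.  Then members `T, T'` of the box opposite off `Fix` satisfy `Y T' ⊆ X T`. [this work] -/
theorem dbox_dom
    (hsh : ∀ k, k < n → bl k →
      (v (k + 1) ∈ openCluster (N ∩ Fix ∩ (edgeSet n v ∪ edgeSet ℓ u)) (v 0) ∨
        v k ∉ openCluster {e | e ∈ edgeSet n v ∪ edgeSet ℓ u ∧ ¬ (e ∈ Fix ∧ e ∈ N) ∧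
          ∀ w ∈ e, w ∉ openCluster (N ∩ Fix ∩ (edgeSet n v ∪ edgeSet ℓ u)) (v (k + 1))} (v 0)) ∧
      (v k ∈ openCluster (N ∩ Fix ∩ (edgeSet n v ∪ edgeSet ℓ u)) (v 0) ∨
        v (k + 1) ∉ openCluster {e | e ∈ edgeSet n v ∪ edgeSet ℓ u ∧ ¬ (e ∈ Fix ∧ e ∈ N) ∧
          ∀ w ∈ e, w ∉ openCluster (N ∩ Fix ∩ (edgeSet n v ∪ edgeSet ℓ u)) (v k)} (v 0)))
    {T T' : Set (Sym2 V)} (hT : ∀ e ∈ Fix, (e ∈ T ↔ e ∈ N)) (hT' : ∀ e ∈ Fix, (e ∈ T' ↔ e ∈ N))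
    (hflip : ∀ e ∉ Fix, (e ∈ T' ↔ e ∉ T)) :
    openCluster (T'ᶜ ∩ (edgeSet n v ∪ edgeSet ℓ u)) (v 0) ⊆ openCluster (T ∩ (edgeSet n v ∪ edgeSet ℓ u)) (v 0) := by
  refine Box.dom_of_shielded (edgeSet n v ∪ edgeSet ℓ u) Fix N (v 0) (fun y z hE hF hNn hz => ?_) hT hT' hflip
  -- the pair `yz` is a fixed-blue cycle pair `edge v k`
  rcases hE with ⟨k, hk, he⟩ | ⟨m, hm, he⟩
  · have hbl : bl k := by
      rcases (dbox_mem_Fix_v hn hinj hper hRC rd bl er Fix hFix hk).1 (he ▸ hF) with h | h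
      · exact absurd ((dbox_mem_N_v hn hinj hper hRC rd er N hN hk).2 h) (he ▸ hNn)
      · exact h
    obtain ⟨h1, h2⟩ := hsh k hk hbl
    unfold edge at he
    rcases Sym2.eq_iff.1 he with ⟨rfl, rfl⟩ | ⟨rfl, rfl⟩
    · exact h1.elim (fun h => absurd h hz) id
    · exact h2.elim (fun h => absurd h hz) id
  · exfalso
    have her : er := (dbox_mem_Fix_u hRC rd bl er Fix hFix hm).1 (he ▸ hF)
    exact hNn (he ▸ (dbox_mem_N_u hRC rd er N hN hm).2 her)

end Cyc

end Antithetic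

end Summit.CriticalPhenomena.PercolationContinuityZ3.Theorems
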